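import Summits.AnomalousDissipation.AnomalousDissipation.Theses.TwoAndHalfD
import Summits.AnomalousDissipation.AnomalousDissipation.Theorems.TwoAndHalfDTwohalfdThesisLine
import Summits.AnomalousDissipation.AnomalousDissipation.Theorems.TwoAndHalfDScalarAnomalySteadySourceFormalColdStartVarianceToolkit
import Literature.Analysis.FluidPDE.TwoHalfNavierStokes
import Literature.Analysis.FluidPDE.TorusClassicalLerayHopfProofs
import Literature.Analysis.FluidPDE.PassiveScalarEnergySlice
import Literature.Analysis.FluidPDE.LongTimeAverageSubadditive

/-!
# T2 `stub_liftBudget`: energy / dissipation budgets of the classical 2½-D lift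

Stub T2 of the line `Sketch` (duhamel-release) for the crux
`Summit.AnomalousDissipation.AnomalousDissipation.Theses.TwoAndHalfD.TwohalfdThesis`
(stmt-AnomalousDissipation-0206); the statement is registered verbatim in the line's checked
skeleton and is consumed by the kernel-checked composition there (`TwohalfdThesis_of`, hypothesis
`hT2`, in `Theorems/TwoAndHalfDTwohalfdThesisLine.lean`).

CONTENT. Let `(v, p)` be a classical solution of the planar Navier–Stokes system on `[0, ∞) × T²`
forced by a steady smooth `g`, and `θ` a classical solution of `∂ₜθ + v·∇θ = νΔθ + h` (steady
smooth source `h`, Prandtl number one), with the pointwise budgets `∫‖v(t)‖² ≤ E` and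
`‖θ(t)‖²_{L²} ≤ B` for `t ≥ 0`. For the lift `u(t) := (v(t), θ(t))∘π : T³ → ℝ³` (`Torus.twoHalf`):
(i) `meanEnergy u = limsup_T T⁻¹∫₀ᵀ ∫‖u(t)‖² ≤ E + B`; (ii) the limsup-mean scalar dissipation
`⟨ν‖∇θ‖²⟩` is at most `meanDissipation ν u = ⟨ν‖∇u‖²⟩` (spectral gradient norms, `toReal`).

PROOF. (i) `∫_{T³}‖(v,θ)∘π‖² = ∫_{T²}‖v‖² + ∫_{T²}θ²` slice-wise (`Torus.integral_norm_sq_twoHalf`),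
so the observable is pointwise `≤ E + B` on `(0, ∞)` and `longTimeAvgSup_le_const` applies.
(ii) Monotonicity of honest long-time averages (`longTimeAvgSup_mono`): pointwise
`‖∇θ(t)‖² ≤ ‖∇v(t)‖² + ‖∇θ(t)‖² = ‖∇u(t)‖²` (`Torus.scalarGradNormSq_le_toReal_eGradNormSq_twoHalf`,
Cheskidov 2023, §6 p. 19), local integrability of `t ↦ ν‖∇u(t)‖²` (continuous on `[0, ∞)`), and —
the one delicate point — boundedness of its running means: the lift is a classical 3-D solution
forced by the steady `F := (g, h)∘π` (`lift_isClassicalNSSolutionOn`), so the energy equality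
(`Torus.IsClassicalNSSolutionOn.energy_eq`, Robinson–Rodrigo–Sadowski 2016, Thm. 6.5) gives
`ν∫₀ᵀ‖∇u‖² = ½‖u(0)‖² - ½‖u(T)‖² + ∫₀ᵀ∫⟪F, u⟫ ≤ ½(E + B) + T‖F‖_{L²}√(E + B)` (Cauchy–Schwarz),
a linear integrated bound (`isBoundedUnder_timeMean_of_setIntegral_le_linear`).
Supports stmt-AnomalousDissipation-0206. [folklore: Doering–Foias 2002, §2; Cheskidov 2023, §6]
-/

noncomputable section

-- the summit path `AnomalousDissipation/AnomalousDissipation` duplicates a namespace component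
set_option linter.dupNamespace false

namespace Summit.AnomalousDissipation.AnomalousDissipation.Theorems.TwohalfdThesis

open MeasureTheory Set Filter Topology
open scoped ENNReal NNReal InnerProductSpace
open Literature.Analysis.FunctionSpaces Literature.Analysis.FluidPDE

/-! ## Cauchy–Schwarz for the input power of a steady force -/

/-- **Cauchy–Schwarz for the `L²` pairing of continuous vector fields on `T^d`**:
`|∫ ⟪F, w⟫| ≤ (∫‖F‖²)^{1/2} (∫‖w‖²)^{1/2}` (`|⟪F, w⟫| ≤ ‖F‖‖w‖` pointwise, then Hölder with
`p = q = 2` for the norms, `ColdStartVariance.integral_mul_le_sqrt_mul_sqrt`). [folklore] -/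
theorem liftBudget_norm_integral_inner_le {d : Type*} [Fintype d]
    {F w : UnitAddTorus d → EuclideanSpace ℝ d} (hF : Continuous F) (hw : Continuous w) :
    ‖∫ x, ⟪F x, w x⟫_ℝ‖ ≤ √(∫ x, ‖F x‖ ^ 2) * √(∫ x, ‖w x‖ ^ 2) := by
  have hFm : MemLp F 2 volume :=
    hF.memLp_of_hasCompactSupport (HasCompactSupport.of_compactSpace F)
  have hwm : MemLp w 2 volume :=
    hw.memLp_of_hasCompactSupport (HasCompactSupport.of_compactSpace w)
  calc ‖∫ x, ⟪F x, w x⟫_ℝ‖ ≤ ∫ x, ‖F x‖ * ‖w x‖ :=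
        norm_integral_le_of_norm_le (hF.norm.mul hw.norm).integrable_unitAddTorus
          (ae_of_all _ fun x => norm_inner_le_norm _ _)
    _ ≤ √(∫ x, ‖F x‖ ^ 2) * √(∫ x, ‖w x‖ ^ 2) :=
        ScalarAnomalySteadySourceFormal.ColdStartVariance.integral_mul_le_sqrt_mul_sqrt hFm.norm
          hwm.norm

/-! ## The stub -/

/-- **T2 `stub_liftBudget` (line `Sketch` = duhamel-release, crux `TwoAndHalfD.TwohalfdThesis`).**
For a classical planar Navier–Stokes solution `(v, p)` on `[0, ∞) × T²` forced by the steady smooth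
`g`, and a classical solution `θ` of `∂ₜθ + v·∇θ = νΔθ + h` (steady smooth `h`, `ν > 0`) with
`∫‖v(t)‖² ≤ E` and `‖θ(t)‖²_{L²} ≤ B` for `t ≥ 0`, the lift `u(t) = (v(t), θ(t))∘π` on `T³` has
`meanEnergy u ≤ E + B` (slice-wise `∫‖u‖² = ∫‖v‖² + ∫θ²`) and `⟨ν‖∇θ‖²⟩ ≤ meanDissipation ν u`
(pointwise `‖∇θ‖² ≤ ‖∇u‖²`; the running means of `ν‖∇u‖²` are bounded by the energy equality of
the classical lift forced by `(g, h)∘π` and Cauchy–Schwarz, so `longTimeAvgSup_mono` applies;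
Doering–Foias 2002, §2; Cheskidov 2023, §6 p. 19). [folklore] -/
theorem stub_liftBudget : ∀ (ν E B : ℝ) (g : (UnitAddTorus (Fin 2)) → (EuclideanSpace ℝ (Fin 2))) (h : (UnitAddTorus (Fin 2)) → ℝ) (v : ℝ → (UnitAddTorus (Fin 2)) → (EuclideanSpace ℝ (Fin 2))) (p : ℝ → (UnitAddTorus (Fin 2)) → ℝ) (θ : ℝ → (UnitAddTorus (Fin 2)) → ℝ), 0 < ν → Torus.IsSmooth g → Torus.IsSmooth h → Torus.IsClassicalNSSolutionOn (Ici 0) ν (fun _ => g) v p → Torus.IsClassicalScalarTransportForcedOn (Ici 0) ν v (fun _ => h) θ → (∀ t, 0 ≤ t → ∫ x, ‖v t x‖ ^ 2 ≤ E) → (∀ t, 0 ≤ t → Torus.scalarL2Sq (θ t) ≤ B) → meanEnergy (fun t => Torus.twoHalf (v t) (θ t)) ≤ E + B ∧ longTimeAvgSup (fun t => ν * (Torus.eScalarGradNormSq (θ t)).toReal) ≤ meanDissipation ν (fun t => Torus.twoHalf (v t) (θ t)) := by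
  intro ν E B g h v p θ hν hg hh hv hθ hE hB
  -- smooth slices of the planar data and of the lift on `[0, ∞)`
  have hvt : ∀ t, 0 ≤ t → Torus.IsSmooth (v t) := fun t ht =>
    hv.smooth_velocity.isSmooth_slice (mem_Ici.2 ht)
  have hθt : ∀ t, 0 ≤ t → Torus.IsSmooth (θ t) := fun t ht =>
    hθ.smooth_scalar.isSmooth_slice (mem_Ici.2 ht)
  have hut : ∀ t, 0 ≤ t → Torus.IsSmooth (Torus.twoHalf (v t) (θ t)) := fun t ht =>
    (hvt t ht).twoHalf (hθt t ht)
  -- pointwise energy budget of the lift: `∫‖u(t)‖² = ∫‖v(t)‖² + ∫θ(t)² ≤ E + B`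
  have hEB : ∀ t, 0 ≤ t → ∫ x, ‖Torus.twoHalf (v t) (θ t) x‖ ^ 2 ≤ E + B := by
    intro t ht
    rw [Torus.integral_norm_sq_twoHalf (hvt t ht).continuous (hθt t ht).continuous]
    exact add_le_add (hE t ht) (hB t ht)
  refine ⟨?_, ?_⟩
  · -- (i) the mean energy
    rw [meanEnergy_eq_longTimeAvgSup]
    exact longTimeAvgSup_le_const (fun t => integral_nonneg fun _ => sq_nonneg _)
      fun t ht => hEB t ht.le
  · -- (ii) the dissipation budget
    show longTimeAvgSup (fun t => ν * (Torus.eScalarGradNormSq (θ t)).toReal) ≤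
      longTimeAvgSup (fun t => ν * (Torus.eGradNormSq (Torus.twoHalf (v t) (θ t))).toReal)
    -- the lift is a classical 3-D solution forced by the steady `(g, h)∘π`
    have H := lift_isClassicalNSSolutionOn ν g h v p θ hv hθ
    -- spectral = classical dissipation on the smooth slices
    have hgeq : ∀ t, 0 ≤ t → ν * (Torus.eGradNormSq (Torus.twoHalf (v t) (θ t))).toReal =
        ν * Torus.gradNormSq (Torus.twoHalf (v t) (θ t)) := fun t ht => by
      rw [Torus.gradNormSq_eq_toReal_eGradNormSq_holds (hut t ht)]
    -- `t ↦ ‖∇u(t)‖²` is continuous on `[0, ∞)`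
    have hGc : ContinuousOn (fun t => Torus.gradNormSq (Torus.twoHalf (v t) (θ t))) (Ici 0) :=
      H.smooth_velocity.continuousOn_gradNormSq (convex_Ici 0) (uniqueDiffOn_Ici 0)
    -- local integrability of the dissipation observable
    have hGi : ∀ T, 0 < T → IntegrableOn
        (fun t => ν * (Torus.eGradNormSq (Torus.twoHalf (v t) (θ t))).toReal) (Ioc 0 T) := by
      intro T _
      have h1 : IntegrableOn (fun t => ν * Torus.gradNormSq (Torus.twoHalf (v t) (θ t)))
          (Ioc 0 T) :=
        Integrable.const_mul (((hGc.mono Icc_subset_Ici_self).integrableOn_compact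
          isCompact_Icc).mono_set Ioc_subset_Icc_self) ν
      exact h1.congr_fun (fun t ht => (hgeq t ht.1.le).symm) measurableSet_Ioc
    -- the running means of the dissipation are bounded (energy equality + Cauchy–Schwarz)
    have hF : Continuous (Torus.twoHalf g h) := (hg.twoHalf hh).continuous
    set C : ℝ := √(∫ x, ‖Torus.twoHalf g h x‖ ^ 2) * √(E + B) with hC
    have hlin : ∀ T, 0 < T →
        ∫ t in Ioc 0 T, ν * (Torus.eGradNormSq (Torus.twoHalf (v t) (θ t))).toReal ≤
          2⁻¹ * (E + B) + C * T := by
      intro T hT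
      have h1 : ∫ t in Ioc 0 T, ν * (Torus.eGradNormSq (Torus.twoHalf (v t) (θ t))).toReal =
          ν * ∫ t in (0 : ℝ)..T, Torus.gradNormSq (Torus.twoHalf (v t) (θ t)) := by
        rw [intervalIntegral.integral_of_le hT.le, ← integral_const_mul]
        exact setIntegral_congr_fun measurableSet_Ioc fun t ht => hgeq t ht.1.le
      have h2 : Torus.kineticEnergy (Torus.twoHalf (v T) (θ T)) +
          ν * ∫ τ in (0 : ℝ)..T, Torus.gradNormSq (Torus.twoHalf (v τ) (θ τ)) =
            Torus.kineticEnergy (Torus.twoHalf (v 0) (θ 0)) +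
              ∫ τ in (0 : ℝ)..T, ∫ x, ⟪Torus.twoHalf g h x, Torus.twoHalf (v τ) (θ τ) x⟫_ℝ :=
        H.energy_eq (convex_Ici 0) hT.le Icc_subset_Ici_self
      have h3 : Torus.kineticEnergy (Torus.twoHalf (v 0) (θ 0)) ≤ 2⁻¹ * (E + B) :=
        mul_le_mul_of_nonneg_left (hEB 0 le_rfl) (by norm_num)
      have h4 : 0 ≤ Torus.kineticEnergy (Torus.twoHalf (v T) (θ T)) :=
        Torus.kineticEnergy_nonneg _
      have hbound : ∀ τ ∈ uIoc (0 : ℝ) T,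
          ‖∫ x, ⟪Torus.twoHalf g h x, Torus.twoHalf (v τ) (θ τ) x⟫_ℝ‖ ≤ C := by
        intro τ hτ
        rw [uIoc_of_le hT.le] at hτ
        have hτ0 : 0 ≤ τ := hτ.1.le
        calc ‖∫ x, ⟪Torus.twoHalf g h x, Torus.twoHalf (v τ) (θ τ) x⟫_ℝ‖
            ≤ √(∫ x, ‖Torus.twoHalf g h x‖ ^ 2) *
                √(∫ x, ‖Torus.twoHalf (v τ) (θ τ) x‖ ^ 2) :=
              liftBudget_norm_integral_inner_le hF (hut τ hτ0).continuous
          _ ≤ C := mul_le_mul_of_nonneg_left (Real.sqrt_le_sqrt (hEB τ hτ0)) (Real.sqrt_nonneg _)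
      have h5 : ∫ τ in (0 : ℝ)..T, ∫ x, ⟪Torus.twoHalf g h x, Torus.twoHalf (v τ) (θ τ) x⟫_ℝ ≤
          C * T := by
        have h6 := intervalIntegral.norm_integral_le_of_norm_le_const hbound
        rw [Real.norm_eq_abs, sub_zero, abs_of_pos hT] at h6
        exact (le_abs_self _).trans h6
      rw [h1]
      linarith
    have hb : IsBoundedUnder (· ≤ ·) atTop
        (timeMean fun t => ν * (Torus.eGradNormSq (Torus.twoHalf (v t) (θ t))).toReal) :=
      isBoundedUnder_timeMean_of_setIntegral_le_linear hlin
    -- monotonicity of honest long-time averages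
    refine longTimeAvgSup_mono (fun t => mul_nonneg hν.le ENNReal.toReal_nonneg)
      (fun t => mul_nonneg hν.le ENNReal.toReal_nonneg) hGi (fun t ht => ?_) hb
    show ν * (Torus.eScalarGradNormSq (θ t)).toReal ≤
      ν * (Torus.eGradNormSq (Torus.twoHalf (v t) (θ t))).toReal
    rw [← Torus.scalarGradNormSq_eq_toReal_holds (hθt t ht.le)]
    exact mul_le_mul_of_nonneg_left
      (Torus.scalarGradNormSq_le_toReal_eGradNormSq_twoHalf (hvt t ht.le) (hθt t ht.le)) hν.le

end Summit.AnomalousDissipation.AnomalousDissipation.Theorems.TwohalfdThesis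

end
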